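import Summits.AnomalousDissipation.AnomalousDissipation.Theorems.SolenoidalFractalHomogenisationRealisedQuasiStaticCellLawInPlaneFloorDefect
import Mathlib.Analysis.SpecialFunctions.Exp
import Mathlib.Analysis.Complex.ExponentialBounds
import Mathlib.Analysis.Real.Pi.Bounds
import HarnessLib

/-!
# K2R `RealisedQuasiStaticCellLaw`, line `floquet-bloch`, stub `stub_lowSectorWeakFar`: scalar inequalities of the W-far road
# at the replayed cell word (helper; `--supports stmt-AnomalousDissipation-20446`)

Summits-side helper file (everything proved; pure real arithmetic, no definitions, no named facts). With `ε = 1/16`,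
`β = 74`, ramp `ρ = 1/2`, `M ≥ 10`, `ν ≤ 1`, `|m_j|² ≥ 1`, `τ_j ≥ 40` and a weakly coupled sector (`10⁴‖ℓ‖ ≤ nν`):
* `far_coupling_sq_small`: `g_j² ≤ 10⁻¹⁰`; `far_slack_one`, `far_slack_two`: the two slack conditions of
  `weak_slot_factor_le`;
* `farSlot_lower`: the per-slot rate `m_j = min(F_j, G_j)` is bounded below by the linear form
  `(8π²M|ℓ|²/n²)τ_j + (2κ₂/|ℓ|²)(s_j − s_j') − κ₂(12‖ℓ‖/n)s_j` in the slot terms (`inPlane_floor_defect`);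
* `far_rate_sum`: the summed linear form dominates the target exponent `8π²·3720·M(1 + (1−δ)c_W/ν²)/n²` once `|ℓ|² ≥ 4`;
* `far_prefactor`: `74·e^c ≤ K/ν` for `K = 8π²·3720·M(1 + c_W) + 300 ≤ nν`.
-/

set_option linter.dupNamespace false

noncomputable section

namespace Summit.AnomalousDissipation.AnomalousDissipation.Theorems.SolenoidalFractalHomogenisation.RealisedQuasiStaticCellLaw

open Real

/-- **Weak coupling**: `g_j² ≤ 10⁻¹⁰` when `10⁴‖ℓ‖ ≤ nν` (`|θ_j| ≤ ‖ℓ‖`, `|m_j|², ‖m_j‖ ≥ 1`). -/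
theorem far_coupling_sq_small {θ a F bm n ν : ℝ} (hθ : |θ| ≤ a) (hF1 : 1 ≤ F) (hbm1 : 1 ≤ bm) (hn : 0 < n)
    (hν : 0 < ν) (han : 10000 * a ≤ n * ν) :
    (θ / (8 * π ^ 2 * F * bm * n * ν)) ^ 2 ≤ 1 / 10 ^ 10 := by
  have hπ := Real.pi_gt_three
  have hden : 72 * (n * ν) ≤ 8 * π ^ 2 * F * bm * n * ν := by
    have h1 : (9 : ℝ) ≤ π ^ 2 := by nlinarith
    have h2 : (1 : ℝ) ≤ F * bm := by nlinarith
    have hnν : 0 < n * ν := mul_pos hn hν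
    nlinarith [mul_le_mul h1 h2 zero_le_one (by linarith), mul_nonneg (sub_nonneg.2 h1) hnν.le,
      mul_nonneg (sub_nonneg.2 (mul_le_mul h1 h2 zero_le_one (by linarith))) hnν.le]
  have hpos : 0 < 8 * π ^ 2 * F * bm * n * ν := by
    have : 0 < n * ν := mul_pos hn hν
    linarith
  have hg : |θ / (8 * π ^ 2 * F * bm * n * ν)| ≤ 1 / 100000 := by
    rw [abs_div, abs_of_pos hpos, div_le_iff₀ hpos]
    have ha : a ≤ n * ν / 10000 := by linarith
    calc |θ| ≤ a := hθ
      _ ≤ n * ν / 10000 := ha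
      _ ≤ 1 / 100000 * (8 * π ^ 2 * F * bm * n * ν) := by linarith
  have h0 : 0 ≤ |θ / (8 * π ^ 2 * F * bm * n * ν)| := abs_nonneg _
  rw [← sq_abs]
  nlinarith

/-- First slack condition at `ε = 1/16`, `β = 74`, `ρ = 1/2`. -/
theorem far_slack_one {G ρ : ℝ} (hG0 : 0 ≤ G) (hG : G ≤ 1 / 10 ^ 10) (hρ : ρ = 1 / 2) :
    80 * 74 * G * (1 + G * (32 / 7) ^ 2) ≤ 1 / 16 * (7 / 16) ^ 3 * (1 - 4 * ρ / 3) := by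
  subst hρ
  nlinarith [mul_le_mul_of_nonneg_left hG hG0]

/-- Second slack condition at `ε = 1/16`, `β = 74`, `ρ = 1/2`: needs `M ≥ 10` (`T_j = 4π²|m_j|²Mτ_j ≥ 14400`). -/
theorem far_slack_two {F M τ ρ : ℝ} (hF1 : 1 ≤ F) (hM10 : 10 ≤ M) (hτ : 40 ≤ τ) (hρ : ρ = 1 / 2) :
    96 * 74 ≤ 1 / 16 * ρ * (7 / 16) ^ 3 * (1 - 4 * ρ / 3) * (4 * π ^ 2 * F * M * τ) ^ 2 := by
  subst hρ
  have hπ := Real.pi_gt_three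
  have h1 : (9 : ℝ) ≤ π ^ 2 := by nlinarith
  have hFM : (10 : ℝ) ≤ F * M := by nlinarith
  have hFMτ : (400 : ℝ) ≤ F * M * τ := by nlinarith
  have hT : (14400 : ℝ) ≤ 4 * π ^ 2 * F * M * τ := by nlinarith
  have hT2 : (14400 : ℝ) ^ 2 ≤ (4 * π ^ 2 * F * M * τ) ^ 2 := pow_le_pow_left₀ (by norm_num) hT 2
  linarith [hT2]

/-- **Per-slot lower bound of the rate** `m_j = min(F_j, G_j)` by a linear form in the slot terms `s_j = slotTerm_j(ℓ,0)`,
`s_j' = slotTerm_j(ℓ,ℓ)` (all frames discharged: `inPlane_floor_defect`, `T_jg_j² = (2π²M/(ν²n²))s_j`,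
`s_jĉ_j² = (s_j − s_j')/|ℓ|²`). -/
theorem farSlot_lower {M ν n A a τ F bm θ s s' t xx xK KK ρ : ℝ}
    (hM : 0 < M) (hν : 0 < ν) (hν1 : ν ≤ 1) (hn : 0 < n) (ha2 : 2 ≤ a) (hA : A = a ^ 2)
    (han : 10000 * a ≤ n * ν) (hF1 : 1 ≤ F) (hbm1 : 1 ≤ bm) (hbmF : bm ^ 2 = F) (hτ : 0 < τ)
    (hθs : τ * (1 / (2 * (2 * π * bm) ^ 4)) * θ ^ 2 = s) (hs0 : 0 ≤ s)
    (hsle : s ≤ τ * A / (32 * π ^ 4)) (hpol : s * t ^ 2 = (s - s') * F)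
    (hxx : xx = a ^ 2) (hxK : xK = n * t) (hKK : KK = (n * bm) ^ 2) (hCS : |xK| ≤ a * (n * bm))
    (hρ : ρ = 1 / 2) :
    8 * π ^ 2 * M * A / n ^ 2 * τ +
          2 * (2 * (1 - 2 * (1 / 16)) * (1 - 4 * ρ / 3) * (2 * π ^ 2 * M / (ν ^ 2 * n ^ 2))) / A * (s - s') -
        2 * (1 - 2 * (1 / 16)) * (1 - 4 * ρ / 3) * (2 * π ^ 2 * M / (ν ^ 2 * n ^ 2)) * (12 * a / n) * s ≤
      min (8 * π ^ 2 * (ν / n ^ 2) * (n / 2) ^ 2 * (M * τ / ν))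
        (2 * (4 * π ^ 2 * F * ν) * (M * τ / ν) *
          (A / (n ^ 2 * F) + (1 - 2 * (1 / 16)) *
            min 2 (2 * (max ((|xK| - xx) / (Real.sqrt xx * (Real.sqrt xx + Real.sqrt KK))) 0) ^ 2 /
              (1 + 2 * |xK| / KK)) *
            ((θ / (8 * π ^ 2 * F * bm * n * ν)) ^ 2 * (1 - 4 * ρ / 3)))) := by
  subst hρ
  have hπ := Real.pi_gt_three
  have hπ0 : 0 < π := pi_pos
  have ha0 : 0 < a := by linarith
  have hbm0 : 0 < bm := by linarith
  have hF0 : 0 < F := by linarith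
  have hA0 : 0 < A := by rw [hA]; positivity
  have hb : 0 < n * bm := by positivity
  have hnν : 0 < n * ν := mul_pos hn hν
  have han1 : 10000 * a ≤ n := by nlinarith
  -- the frame-free in-plane floor
  rw [hxx, hKK, Real.sqrt_sq ha0.le, Real.sqrt_sq hb.le]
  have hc1 : (|xK| / (a * (n * bm))) ^ 2 ≤ 1 := by
    rw [div_pow, div_le_one (by positivity)]
    exact pow_le_pow_left₀ (abs_nonneg _) hCS 2
  have hSFL : 2 * (|xK| / (a * (n * bm))) ^ 2 - 12 * (a / (n * bm)) ≤
      min 2 (2 * (max ((|xK| - a ^ 2) / (a * (a + n * bm))) 0) ^ 2 / (1 + 2 * |xK| / (n * bm) ^ 2)) := by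
    refine le_min ?_ (inPlane_floor_defect ha0 hb (abs_nonneg _) hCS (by nlinarith))
    have : 0 ≤ 12 * (a / (n * bm)) := by positivity
    linarith
  -- the coupling exponent and the polarisation factor in slot terms
  have hTg : (4 * π ^ 2 * F * ν) * (M * τ / ν) * (θ / (8 * π ^ 2 * F * bm * n * ν)) ^ 2 =
      2 * π ^ 2 * M / (ν ^ 2 * n ^ 2) * s := by
    rw [← hθs, ← hbmF]
    field_simp
    ring
  have hc2 : (|xK| / (a * (n * bm))) ^ 2 = t ^ 2 / (A * F) := by
    rw [div_pow, sq_abs, hxK, hA, ← hbmF]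
    field_simp
  have ht2 : t ^ 2 ≤ A * F := by
    have h1 : |xK| ^ 2 ≤ (a * (n * bm)) ^ 2 := pow_le_pow_left₀ (abs_nonneg _) hCS 2
    rw [sq_abs, hxK] at h1
    rw [hA, ← hbmF]
    nlinarith [pow_pos hn 2]
  have hd0 : 2 * (4 * π ^ 2 * F * ν) * (M * τ / ν) * (A / (n ^ 2 * F)) = 8 * π ^ 2 * M * A / n ^ 2 * τ := by
    field_simp
    ring
  -- `s·floor ≥ 2(s − s')/A − (12a/n)s`
  have hss' : (s - s') / A = s * (t ^ 2 / (A * F)) := by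
    rw [div_eq_iff hA0.ne']
    field_simp
    linarith [hpol]
  have hkey : 2 / A * (s - s') - 12 * a / n * s ≤
      s * min 2 (2 * (max ((|xK| - a ^ 2) / (a * (a + n * bm))) 0) ^ 2 / (1 + 2 * |xK| / (n * bm) ^ 2)) := by
    have h1 := mul_le_mul_of_nonneg_left hSFL hs0
    have h2 : 12 * a / (n * bm) * s ≤ 12 * a / n * s := by
      apply mul_le_mul_of_nonneg_right _ hs0
      exact div_le_div_of_nonneg_left (by positivity) hn (le_mul_of_one_le_right hn.le hbm1)
    have h3 : 2 / A * (s - s') = s * (2 * (|xK| / (a * (n * bm))) ^ 2) := by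
      rw [hc2, show 2 / A * (s - s') = 2 * ((s - s') / A) by ring, hss']
      ring
    calc 2 / A * (s - s') - 12 * a / n * s
        = s * (2 * (|xK| / (a * (n * bm))) ^ 2) - 12 * a / n * s := by rw [h3]
      _ ≤ s * (2 * (|xK| / (a * (n * bm))) ^ 2) - 12 * a / (n * bm) * s := by linarith only [h2]
      _ = s * (2 * (|xK| / (a * (n * bm))) ^ 2 - 12 * (a / (n * bm))) := by ring
      _ ≤ _ := h1
  have hκ2 : 0 ≤ 2 * (1 - 2 * (1 / 16)) * (1 - 4 * (1 / 2 : ℝ) / 3) * (2 * π ^ 2 * M / (ν ^ 2 * n ^ 2)) := by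
    have : (0 : ℝ) ≤ 1 - 4 * (1 / 2) / 3 := by norm_num
    positivity
  refine le_min ?_ ?_
  · -- against the free-decay branch `2π²Mτ`
    have hfree : 8 * π ^ 2 * (ν / n ^ 2) * (n / 2) ^ 2 * (M * τ / ν) = 2 * π ^ 2 * M * τ := by
      field_simp
      norm_num
    rw [hfree]
    have hss : (s - s') / A ≤ s := by
      rw [hss']
      have : t ^ 2 / (A * F) ≤ 1 := by rw [div_le_one (by positivity)]; exact ht2
      exact mul_le_of_le_one_right hs0 this
    have hu : a / n ≤ 1 / 10000 := by rw [div_le_iff₀ hn]; linarith only [han1]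
    have hv : a / (n * ν) ≤ 1 / 10000 := by rw [div_le_iff₀ hnν]; linarith only [han]
    have hu0 : 0 ≤ a / n := by positivity
    have hv0 : 0 ≤ a / (n * ν) := by positivity
    have e1 : 8 * π ^ 2 * M * A / n ^ 2 * τ = 8 * π ^ 2 * M * τ * (a / n) ^ 2 := by
      rw [hA]; field_simp
    have e2 : 2 * π ^ 2 * M / (ν ^ 2 * n ^ 2) * (τ * A / (32 * π ^ 4)) = M * τ / (16 * π ^ 2) * (a / (n * ν)) ^ 2 := by
      rw [hA]; field_simp; ring
    have b1 : (a / n) ^ 2 ≤ 1 / 10 ^ 8 := by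
      have := mul_le_mul hu hu hu0 (by norm_num); nlinarith only [this]
    have b2 : (a / (n * ν)) ^ 2 ≤ 1 / 10 ^ 8 := by
      have := mul_le_mul hv hv hv0 (by norm_num); nlinarith only [this]
    have hMτ : 0 < M * τ := mul_pos hM hτ
    have t1 : 8 * π ^ 2 * M * A / n ^ 2 * τ ≤ 8 * π ^ 2 * M * τ * (1 / 10 ^ 8) := by
      rw [e1]; exact mul_le_mul_of_nonneg_left b1 (by positivity)
    have t2 : 2 * (2 * (1 - 2 * (1 / 16)) * (1 - 4 * (1 / 2 : ℝ) / 3) * (2 * π ^ 2 * M / (ν ^ 2 * n ^ 2))) / A *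
        (s - s') ≤ 2 * (2 * (1 - 2 * (1 / 16)) * (1 - 4 * (1 / 2 : ℝ) / 3)) * (M * τ / (16 * π ^ 2) * (1 / 10 ^ 8)) := by
      have step1 : 2 * (2 * (1 - 2 * (1 / 16)) * (1 - 4 * (1 / 2 : ℝ) / 3) * (2 * π ^ 2 * M / (ν ^ 2 * n ^ 2))) / A *
          (s - s') = 2 * (2 * (1 - 2 * (1 / 16)) * (1 - 4 * (1 / 2 : ℝ) / 3)) *
            (2 * π ^ 2 * M / (ν ^ 2 * n ^ 2) * ((s - s') / A)) := by
        field_simp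
      rw [step1]
      refine mul_le_mul_of_nonneg_left ?_ (by norm_num)
      calc 2 * π ^ 2 * M / (ν ^ 2 * n ^ 2) * ((s - s') / A)
          ≤ 2 * π ^ 2 * M / (ν ^ 2 * n ^ 2) * (τ * A / (32 * π ^ 4)) :=
            mul_le_mul_of_nonneg_left (hss.trans hsle) (by positivity)
        _ = M * τ / (16 * π ^ 2) * (a / (n * ν)) ^ 2 := e2
        _ ≤ M * τ / (16 * π ^ 2) * (1 / 10 ^ 8) := mul_le_mul_of_nonneg_left b2 (by positivity)
    have t3 : 0 ≤ 2 * (1 - 2 * (1 / 16)) * (1 - 4 * (1 / 2 : ℝ) / 3) * (2 * π ^ 2 * M / (ν ^ 2 * n ^ 2)) *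
        (12 * a / n) * s := by positivity
    have t4 : M * τ / (16 * π ^ 2) ≤ M * τ := by
      rw [div_le_iff₀ (by positivity)]
      have : (1 : ℝ) ≤ 16 * π ^ 2 := by nlinarith only [hπ]
      nlinarith only [this, hMτ]
    have hπ2 : 9 ≤ π ^ 2 := by nlinarith only [hπ]
    nlinarith only [t1, t2, t3, t4, hMτ, hπ2, mul_le_mul_of_nonneg_left hπ2 hMτ.le]
  · -- against the coupling branch
    have e : 2 * (4 * π ^ 2 * F * ν) * (M * τ / ν) *
        (A / (n ^ 2 * F) + (1 - 2 * (1 / 16)) *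
          min 2 (2 * (max ((|xK| - a ^ 2) / (a * (a + n * bm))) 0) ^ 2 / (1 + 2 * |xK| / (n * bm) ^ 2)) *
          ((θ / (8 * π ^ 2 * F * bm * n * ν)) ^ 2 * (1 - 4 * (1 / 2 : ℝ) / 3))) =
        8 * π ^ 2 * M * A / n ^ 2 * τ + 2 * (1 - 2 * (1 / 16)) * (1 - 4 * (1 / 2 : ℝ) / 3) *
          ((4 * π ^ 2 * F * ν) * (M * τ / ν) * (θ / (8 * π ^ 2 * F * bm * n * ν)) ^ 2) *
          min 2 (2 * (max ((|xK| - a ^ 2) / (a * (a + n * bm))) 0) ^ 2 / (1 + 2 * |xK| / (n * bm) ^ 2)) := by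
      rw [← hd0]; ring
    rw [e, hTg]
    have h := mul_le_mul_of_nonneg_left hkey hκ2
    have e3 : 2 * (2 * (1 - 2 * (1 / 16)) * (1 - 4 * (1 / 2 : ℝ) / 3) * (2 * π ^ 2 * M / (ν ^ 2 * n ^ 2))) / A *
          (s - s') - 2 * (1 - 2 * (1 / 16)) * (1 - 4 * (1 / 2 : ℝ) / 3) * (2 * π ^ 2 * M / (ν ^ 2 * n ^ 2)) *
          (12 * a / n) * s =
        2 * (1 - 2 * (1 / 16)) * (1 - 4 * (1 / 2 : ℝ) / 3) * (2 * π ^ 2 * M / (ν ^ 2 * n ^ 2)) *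
          (2 / A * (s - s') - 12 * a / n * s) := by
      field_simp
    have e4 : 2 * (1 - 2 * (1 / 16)) * (1 - 4 * (1 / 2 : ℝ) / 3) * (2 * π ^ 2 * M / (ν ^ 2 * n ^ 2)) *
        (s * min 2 (2 * (max ((|xK| - a ^ 2) / (a * (a + n * bm))) 0) ^ 2 / (1 + 2 * |xK| / (n * bm) ^ 2))) =
        2 * (1 - 2 * (1 / 16)) * (1 - 4 * (1 / 2 : ℝ) / 3) * (2 * π ^ 2 * M / (ν ^ 2 * n ^ 2) * s) *
          min 2 (2 * (max ((|xK| - a ^ 2) / (a * (a + n * bm))) 0) ^ 2 / (1 + 2 * |xK| / (n * bm) ^ 2)) := by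
      ring
    linarith only [h, e3, e4]

/-- **The summed linear form dominates the target exponent** once `|ℓ|² ≥ 4` (`Σ_jτ_j = 3720`,
`Σ_j(s_j − s_j') = (1/3)c0·3720|ℓ|⁴`, `Σ_j s_j = 280|ℓ|²/(32π⁴)`, `‖ℓ‖ ≤ 10⁻⁴n`). -/
theorem far_rate_sum {M ν n A a δ ρ cc : ℝ} (hM : 0 < M) (hν : 0 < ν) (hn : 0 < n) (ha2 : 2 ≤ a) (hA : A = a ^ 2)
    (han : 10000 * a ≤ n) (hδ : 0 ≤ δ) (hρ : ρ = 1 / 2) (hcc : cc = 7 / (4960 * π ^ 4)) :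
    8 * π ^ 2 * 3720 * M * (1 + (1 - δ) * ((1 - 4 * ρ / 3) * cc) / ν ^ 2) / n ^ 2 ≤
      8 * π ^ 2 * M * A / n ^ 2 * 3720 +
          2 * (2 * (1 - 2 * (1 / 16)) * (1 - 4 * ρ / 3) * (2 * π ^ 2 * M / (ν ^ 2 * n ^ 2))) / A *
            (1 / 3 * (cc * 3720) * A ^ 2) -
        2 * (1 - 2 * (1 / 16)) * (1 - 4 * ρ / 3) * (2 * π ^ 2 * M / (ν ^ 2 * n ^ 2)) * (12 * a / n) *
          (280 * A / (32 * π ^ 4)) := by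
  subst hρ hcc
  have hπ := Real.pi_gt_three
  have hπ0 : 0 < π := pi_pos
  have ha0 : 0 < a := by linarith
  have hA0 : 0 < A := by rw [hA]; positivity
  have hA4 : 4 ≤ A := by rw [hA]; nlinarith
  have hu : a / n ≤ 1 / 10000 := by rw [div_le_iff₀ hn]; linarith
  have hu0 : 0 ≤ a / n := by positivity
  rw [← sub_nonneg]
  have e : 8 * π ^ 2 * M * A / n ^ 2 * 3720 +
          2 * (2 * (1 - 2 * (1 / 16)) * (1 - 4 * (1 / 2 : ℝ) / 3) * (2 * π ^ 2 * M / (ν ^ 2 * n ^ 2))) / A *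
            (1 / 3 * (7 / (4960 * π ^ 4) * 3720) * A ^ 2) -
        2 * (1 - 2 * (1 / 16)) * (1 - 4 * (1 / 2 : ℝ) / 3) * (2 * π ^ 2 * M / (ν ^ 2 * n ^ 2)) * (12 * a / n) *
          (280 * A / (32 * π ^ 4)) -
        8 * π ^ 2 * 3720 * M * (1 + (1 - δ) * ((1 - 4 * (1 / 2 : ℝ) / 3) * (7 / (4960 * π ^ 4))) / ν ^ 2) / n ^ 2 =
      M / (π ^ 2 * ν ^ 2 * n ^ 2) *
        (8 * π ^ 4 * 3720 * ν ^ 2 * (A - 1) + 49 / 12 * A - 245 / 2 * (a / n) * A - 14 * (1 - δ)) := by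
    field_simp
    ring
  rw [e]
  refine mul_nonneg (by positivity) ?_
  have h1 : 0 ≤ 8 * π ^ 4 * 3720 * ν ^ 2 * (A - 1) := by
    have : 0 ≤ A - 1 := by linarith
    positivity
  nlinarith [mul_le_mul_of_nonneg_right hu hA0.le]

/-- **Prefactor**: with `K = 8π²·3720·M(1 + c_W) + 300 ≤ nν`, `ν ≤ 1`: the exponent `c ≤ 1` and `74e^c ≤ K/ν`. -/
theorem far_prefactor {M ν n δ cW c : ℝ} (hM : 0 < M) (hν : 0 < ν) (hν1 : ν ≤ 1) (hn : 0 < n) (hδ : 0 ≤ δ)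
    (hcW : 0 < cW) (hKn : 8 * π ^ 2 * 3720 * M * (1 + cW) + 300 ≤ n * ν)
    (hc : c = 8 * π ^ 2 * 3720 * M * (1 + (1 - δ) * cW / ν ^ 2) / n ^ 2) :
    c ≤ 1 ∧ 74 * Real.exp c ≤ (8 * π ^ 2 * 3720 * M * (1 + cW) + 300) / ν := by
  have hK0 : 0 < 8 * π ^ 2 * 3720 * M * (1 + cW) := by positivity
  have hnν : 0 < n * ν := mul_pos hn hν
  have hc1 : c ≤ 1 := by
    rw [hc, div_le_one (by positivity)]
    have h1 : (1 - δ) * cW / ν ^ 2 ≤ cW / ν ^ 2 := by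
      apply div_le_div_of_nonneg_right _ (by positivity)
      nlinarith
    have h2 : 1 + cW / ν ^ 2 ≤ (1 + cW) / ν ^ 2 := by
      rw [le_div_iff₀ (by positivity), add_mul, div_mul_cancel₀ _ (by positivity)]
      nlinarith [mul_le_mul hν1 hν1 hν.le zero_le_one]
    have h3 : 8 * π ^ 2 * 3720 * M * (1 + (1 - δ) * cW / ν ^ 2) ≤ 8 * π ^ 2 * 3720 * M * ((1 + cW) / ν ^ 2) :=
      mul_le_mul_of_nonneg_left (by linarith) (by positivity)
    have h4 : 8 * π ^ 2 * 3720 * M * ((1 + cW) / ν ^ 2) = 8 * π ^ 2 * 3720 * M * (1 + cW) / ν ^ 2 := by ring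
    have h5 : 8 * π ^ 2 * 3720 * M * (1 + cW) / ν ^ 2 ≤ n ^ 2 := by
      rw [div_le_iff₀ (by positivity)]
      have : 8 * π ^ 2 * 3720 * M * (1 + cW) ≤ (n * ν) ^ 2 := by nlinarith
      nlinarith
    linarith
  refine ⟨hc1, ?_⟩
  have he : Real.exp c ≤ Real.exp 1 := Real.exp_le_exp.2 hc1
  have he1 := Real.exp_one_lt_d9
  rw [le_div_iff₀ hν]
  nlinarith [Real.exp_pos c, mul_le_mul_of_nonneg_left hν1 (Real.exp_pos c).le]

end Summit.AnomalousDissipation.AnomalousDissipation.Theorems.SolenoidalFractalHomogenisation.RealisedQuasiStaticCellLaw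

end
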